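/-
Copyright (c) 2026 the pub-hodgecm-mathlib formalisation cell (harness21).  Prover seat hodgecm-mathlib-F0P3a-p01 (g37), FLOOR 0, SUPPORTS-ONLY on h413; β-BOARD v1 row R1
(sub-dealer LH4-p05 (g8), heir LEAD T20-16 (R-35)(b)): the CORE cell of the (β) Stage-B table.  2026-09-04.
-/
import Summits.HodgeConjecture.HodgeConjecture.Theorems.F0P3cDyRamLabelledSplitStrata   -- ★ p859094 (LH4-p09 (g8)): `latticeInLevel_diagonal_stdLattice_iff`, `finsum_mem_sep_eq_ite_of_forall_iff`; brings ★ StrataDefs `stratum`, `stdLattice`, ★ CensusDefs `LatticeInLevel`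
import Summits.HodgeConjecture.HodgeConjecture.Theorems.F0P3cDyRamLabelledOddCountDefs   -- ★ p860257 (LH4-p11 (g8)): DEFS `labelledOddCount` (the board's weight)
import HarnessLib

/-!
# Crux `H413`, line LH4 «(D-RAM) FOUR-FRAME» — (β-BAL) Stage B, β-BOARD v1 row R1: THE CORE CELL `![0,0,0]` OF THE CLEAN-SHELL TABLE IS EMPTY

Cell `hodgecm-mathlib` (D-0151), FLOOR 0, crux item H413 = `stmt-HodgeConjecture-24833`, route `HCCMUnconditional`; squad F0∕P3c∕LH4.  THEOREMS ONLY (no `def`, no instance, no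
notation, no `sorry`, default heartbeats); ★-only imports; lane `--supports stmt-HodgeConjecture-24833 --as helper` (count-neutral); pays NO row, states NO law.

THE MATHEMATICS (LH4-p05 (g8) ROW LEDGER 14:46:05Z (P1) ∕ β-BOARD v1 R1; consumer: the (T2) TRUNK `…LabelledOddStageBTable.hbox_of_oddBoxSum`, binder `hcore` of (T1)
`F0P3cDyRamOddLabelledBoxSumDefs.OddLabelledBoxSum`).  Every member of the stratum with axis vector `(0,0,0)` is the standard lattice `𝒪³` (normalised + axis exponents `0`;
F0P3a-p01 (g36) ★ p859655's `hmem` step, made a lemma); on `𝒪³` the diagonal token `diag(α−1, β−1, 0)` lies in EVERY level `ℓ ≤ min(v(α−1), v(β−1))` (★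
`latticeInLevel_diagonal_stdLattice_iff`), in particular in level `ℓ₀ + 1 = d % 2 + 1 ≤ N₀`; so the EXACT-shell clause `¬ LatticeInLevel ϖ (d%2+1) X M` fails on the whole stratum and
the clean-shell cut of the core stratum is empty — its table is `0` for ANY weight (§2), in particular for the labelled odd weight of the board's common shape (§3).
HONEST LABEL.  Count-neutral helper (one cell of the box, value `0`); the table identity, (β-BAL), (β), T₊ remain OPEN; `HC_CM` is proved only modulo the 7 printed citations
(2 remaining named inputs: hLiu418 = `stmt-HodgeConjecture-24832`, h413 = `stmt-HodgeConjecture-24833`) until rung 0 closes.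

## References
* [Kottwitz1986BaseChangeUnits] R. E. Kottwitz, *Base change for unit elements of Hecke algebras*, Compositio Math. 60 (1986), §1 pp. 240–241 (lattice counts by torus orbits and strata).
* [Serre1980Trees] J.-P. Serre, *Trees*, Springer (1980), Ch. II §1.1 (lattices `g·𝒪^N`, the standard lattice as the root vertex).
* [Rogawski1990] J. D. Rogawski, *Automorphic Representations of Unitary Groups in Three Variables*, Ann. of Math. Stud. 123 (1990), §4.9 Prop. 4.9.1 (a)(b) p. 55.
-/

set_option autoImplicit false

noncomputable section

namespace Summit.HodgeConjecture.HodgeConjecture.Cruxes.H413.F0P3cDyRamLabelledOddCoreCell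

open Literature.NumberTheory.Automorphic Literature.NumberTheory.Automorphic.HermitianLattice
open Literature.NumberTheory.Automorphic.UnitaryLatticeTree Literature.NumberTheory.Automorphic.UnitaryThreeFourFrame
open Summit.HodgeConjecture.HodgeConjecture.Cruxes.H413.F0P3cDyRamDiagonalTorusDefs
open Summit.HodgeConjecture.HodgeConjecture.Cruxes.H413.F0P3cDyRamDiagonalStrataDefs
open Summit.HodgeConjecture.HodgeConjecture.Cruxes.H413.F0P3cDyRamFourFrameCensusDefs
open Summit.HodgeConjecture.HodgeConjecture.Cruxes.H413.F0P3cDyRamLabelledOddCountDefs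
open Summit.HodgeConjecture.HodgeConjecture.Cruxes.H413.F0P3cDyRamLabelledSplitStrata
open scoped Valued WithZero Matrix MatrixGroups

variable {K : Type} [Field K] [Valued K ℤᵐ⁰] {σ : K →+* K} {ϖ : K} {d t : ℕ} {α β : K} {N₀ n₁ n₂ n₃ : ℕ}

/-! ## §1  The core stratum is `{𝒪³}` -/

/-- **EVERY MEMBER OF THE STRATUM `(0,0,0)` IS THE STANDARD LATTICE `𝒪³`** (any `T`): normalised gives `M ⊆ 𝒪³`, the axis exponents `0` give `e_j ∈ M` for the three basis
vectors (F0P3a-p01 (g36) ★ p859655's `hmem`, as a lemma). [cite: Serre1980Trees, Ch. II §1.1] [cite: Kottwitz1986BaseChangeUnits, §1 pp. 240–241] -/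
theorem eq_stdLattice_of_mem_stratum_core (T : GL (Fin 3) K) {M : Submodule 𝒪[K] (Fin 3 → K)} (hM : M ∈ stratum σ ϖ T ![0, 0, 0]) :
    M = stdLattice K 3 := by
  obtain ⟨⟨-, -, hN⟩, -, hax⟩ := hM
  refine le_antisymm (fun w hw => mem_stdLattice.2 fun j => (hN j).1 w hw) (fun w hw => ?_)
  have hw' : ∀ j, Valued.v (w j) ≤ 1 := fun j => mem_stdLattice.1 hw j
  rw [← Finset.univ_sum_single w]
  refine M.sum_mem fun j _ => ?_
  have e0 : ((![0, 0, 0] : Fin 3 → ℕ) j) = 0 := by fin_cases j <;> rfl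
  exact (hax j (w j)).2 (by rw [e0, pow_zero]; exact hw' j)

/-- **ON THE CORE STRATUM THE DIAGONAL TOKEN `diag(α−1, β−1, 0)` LIES IN EVERY LEVEL `ℓ ≤ min(v(α−1), v(β−1))`** — here at an element datum with threshold `N₀` and any
`ℓ ≤ N₀` (★ `latticeInLevel_diagonal_stdLattice_iff`). [cite: Serre1980Trees, Ch. II §1.1] [cite: Rogawski1990, §4.9 Prop. 4.9.1 (a) p. 55] -/
theorem latticeInLevel_diagonal_of_mem_stratum_core (hD : IsRamifiedQuadraticDatum σ ϖ d t) (hE : IsElementDatum σ ϖ N₀ α β n₁ n₂ n₃)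
    (T : GL (Fin 3) K) {ℓ : ℕ} (hℓ : ℓ ≤ N₀) {M : Submodule 𝒪[K] (Fin 3 → K)} (hM : M ∈ stratum σ ϖ T ![0, 0, 0]) :
    LatticeInLevel ϖ ℓ (Matrix.diagonal ![α - 1, β - 1, 0]) M := by
  have hϖ : Valued.v ϖ = WithZero.exp (-1 : ℤ) := hD.2.2.1
  have hϖ0 : ϖ ≠ 0 := fun h0 => by rw [h0, map_zero] at hϖ; exact WithZero.coe_ne_zero hϖ.symm
  have hϖ1 : Valued.v ϖ ≤ 1 := by rw [hϖ, ← WithZero.exp_zero, WithZero.exp_le_exp]; norm_num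
  have hα : Valued.v (α - 1) = Valued.v ϖ ^ n₂ := hE.2.2.2.2.2.2.1
  have hβ : Valued.v (β - 1) = Valued.v ϖ ^ n₁ := hE.2.2.2.2.2.1
  have hn₁ : N₀ ≤ n₁ := hE.2.2.2.2.2.2.2.2.1
  have hn₂ : N₀ ≤ n₂ := hE.2.2.2.2.2.2.2.2.2.1
  rw [eq_stdLattice_of_mem_stratum_core T hM, latticeInLevel_diagonal_stdLattice_iff hϖ0 ℓ _]
  simp only [Matrix.cons_val_zero, Matrix.cons_val_one, Matrix.cons_val_two, Matrix.tail_cons, Matrix.head_cons, map_zero, zero_le, and_true]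
  exact ⟨hα ▸ pow_le_pow_right_of_le_one' hϖ1 (by omega), hβ ▸ pow_le_pow_right_of_le_one' hϖ1 (by omega)⟩

/-! ## §2  The clean-shell cut of the core stratum is empty: its table vanishes for any weight -/

/-- **THE CORE CELL OF THE CLEAN-SHELL TABLE IS EMPTY — ANY WEIGHT, ANY SQUARE-LEVEL CLAUSE.**  At an element datum with threshold `N₀ ≥ d % 2 + 1` the exact-shell clause
`¬ LatticeInLevel ϖ (d%2+1) diag(α−1, β−1, 0) M` fails on every member of the stratum `(0,0,0)`, so for any predicate `R` and weight `f`: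
`Σᶠ_{M ∈ stratum (0,0,0), LatticeInLevel (d%2) X M ∧ ¬ LatticeInLevel (d%2+1) X M ∧ R M} f M = 0`.
[cite: Kottwitz1986BaseChangeUnits, §1 pp. 240–241] [cite: Serre1980Trees, Ch. II §1.1] [cite: Rogawski1990, §4.9 Prop. 4.9.1 (a)(b) p. 55] -/
theorem finsum_stratum_core_sep_shell_eq_zero (hD : IsRamifiedQuadraticDatum σ ϖ d t) (hE : IsElementDatum σ ϖ N₀ α β n₁ n₂ n₃) (hN₀ : d % 2 + 1 ≤ N₀)
    (T : GL (Fin 3) K) (R : Submodule 𝒪[K] (Fin 3 → K) → Prop) (f : Submodule 𝒪[K] (Fin 3 → K) → ℚ) :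
    ∑ᶠ M ∈ {M : Submodule 𝒪[K] (Fin 3 → K) | M ∈ stratum σ ϖ T ![0, 0, 0] ∧
        (LatticeInLevel ϖ (d % 2) (Matrix.diagonal ![α - 1, β - 1, 0]) M ∧ ¬ LatticeInLevel ϖ (d % 2 + 1) (Matrix.diagonal ![α - 1, β - 1, 0]) M ∧ R M)},
      f M = 0 := by
  classical
  rw [finsum_mem_sep_eq_ite_of_forall_iff (stratum σ ϖ T ![0, 0, 0]) _ False (fun M hM => ?_) f, if_neg not_false]
  simp only [iff_false, not_and]
  intro _ h
  exact absurd (latticeInLevel_diagonal_of_mem_stratum_core hD hE T hN₀ hM) h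

/-! ## §3  β-BOARD v1 row R1 in the board's common shape -/

/-- **β-BOARD v1 ROW R1 — THE CORE CELL `![0,0,0]` OF THE LABELLED-ODD CLEAN-SHELL TABLE IS `0`** (board common shape: `hD`, `h2d`, `hE` at `N₀` with `mcOfRecord d ≤ N₀` —
here only `d % 2 + 1 ≤ N₀` is used, which `2 ≤ d ≤ mcOfRecord d ≤ N₀` implies — `T`, `hT` unused, slot `i`, label `Λ` arbitrary):
`Σᶠ_{M ∈ stratum (0,0,0), clean shell} labelledOddCount σ ϖ 0 i Λ M ∕ [𝒰 : N S̃′(M)] = 0` — the binder `hcore` of (T1) `OddLabelledBoxSum`.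
[cite: Kottwitz1986BaseChangeUnits, §1 pp. 240–241] [cite: Rogawski1990, §4.9 Prop. 4.9.1 (a)(b) p. 55] [cite: Serre1980Trees, Ch. II §1.1] -/
theorem finsum_stratum_core_shell_labelledOdd_div_relIndex_eq_zero (hD : IsRamifiedQuadraticDatum σ ϖ d t) (hE : IsElementDatum σ ϖ N₀ α β n₁ n₂ n₃)
    (hN₀ : d % 2 + 1 ≤ N₀) (T : GL (Fin 3) K) (ℓ₂ : ℕ) (i : Fin 3) (Λ : Submodule 𝒪[K] (Fin 3 → K) → (Fin 3 → K) → Prop) :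
    ∑ᶠ M ∈ {M : Submodule 𝒪[K] (Fin 3 → K) | M ∈ stratum σ ϖ T ![0, 0, 0] ∧
        (LatticeInLevel ϖ (d % 2) (Matrix.diagonal ![α - 1, β - 1, 0]) M ∧ ¬ LatticeInLevel ϖ (d % 2 + 1) (Matrix.diagonal ![α - 1, β - 1, 0]) M ∧
          LatticeInLevel ϖ ℓ₂ (Matrix.diagonal ![(α - 1) * (α - 1), (β - 1) * (β - 1), 0]) M)},
      (labelledOddCount σ ϖ 0 i Λ M : ℚ) / ((((unitStabilizer M).map (unitNormMap σ 3)).relIndex (fixedUnitTorus σ 3) : ℕ) : ℚ) = 0 :=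
  finsum_stratum_core_sep_shell_eq_zero hD hE hN₀ T _ _

end Summit.HodgeConjecture.HodgeConjecture.Cruxes.H413.F0P3cDyRamLabelledOddCoreCell

end
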